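import Summits.QuantumFields.BalabanUV.T4Continuum.Support.NE7TensionPairing
import Summits.QuantumFields.BalabanUV.T4Continuum.Support.NE3PureGaugeFirstVariation
import Summits.QuantumFields.BalabanUV.T4Continuum.Support.NE3HilbertSchmidtTorus

/-!
# NE7ExactCurrent — THE EXACT FIRST-VARIATION FUNCTIONAL `τ = dAction U · (period window)` OF THE PERIODIC WILSON ACTION: linear in the direction,
# EXACTLY zero on pure gauge directions (the tree's `dAction_gaugeDir`), `12·#Plane·a²·‖ψ‖_{ℓ¹}`-close to the tension pairing (gen 62's
# `NE7TensionPairing`), and packaged as a continuous linear functional on the Hilbert–Schmidt torus 1-forms — the `τ` of (E3″)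
# (`NE7TensionKernelCoercivity.normSq_le_of_exact_annihilator`)

Cell `pub-balaban`, rung (B)+1 sub-cell t4, lineage `b2b-balaban-t4-ne7-p1`, generation 62 (CRUX PROVER NE7 #1, ruling e34b3e0c (2)); hunt (h7)
«ENERGY ROAD», memo v2 §6 (`t4/b2b-balaban-t4-ne7-p1-g62/HUNT-H7-ENERGY-ROAD-v2.md`).  WHY.  Step (E3) needs a functional that annihilates the tangent
directions of the constrained minimiser AND the gauge modes EXACTLY (then it annihilates `ker S` of the straight average, v1.2 §4 of
`NE7TensionKernelCoercivity`, and the exact-current form v1.3 §5 applies with NO θ-budget); the tension pairing `⟨frame U ψ, T⟩` does both only up to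
`O(a²)‖ψ‖_{ℓ¹}`.  The EXACT object is the tree's first variation `NE3HessForm.dAction U ψ W = −Σ_{p∈W} Re tr((d_Uψ)(p)·U(∂p))∕n`:
* §1 `dAction_add`, `dAction_smul` (linearity in `ψ`; `curl_add`, `Ad_real_smul`), `hasDerivAt_fineAction_vary_dAction` (`dAction` IS the derivative at
  `s = 0` of `s ↦ fineAction (vary U ψ s) W`; the tree's `hasDerivAt_fineAction_vary_at`);
* §2 **`dAction_sub_tension_pairing_le`**: `|dAction U ψ (plaqsOf (periodBox P)) − Σ_x Σ_ν hsR (frame U ψ x ν) (T_ν(x))| ≤ 12·#Plane·a²·dirL1 ψ (periodBox P)`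
  (gen 62's `firstVariation_sub_tension_pairing_le` with `D := dAction`); §3 `isSkewDir_gaugeDir`, and — the tree's `NE3PureGaugeFirstVariation.dAction_gaugeDir`
  BY NAME (`dAction U (gaugeDir U ζ) W = 0` for EVERY window, exact) — **`tension_pairing_gaugeDir_le`**: the tension is `a²`-orthogonal to every periodic
  pure gauge direction;
* §4 ON THE TORUS 1-FORMS `NE3HilbertSchmidtTorus.Form d n P`: **`exists_exactCurrent`** (`∃ τ : Form d n P →L[ℝ] ℝ, τ b = dAction U (extF P b) W`; no def),
  `dirL1_extF_le` (`dirL1 (extF P b) (periodBox P) ≤ √(d·P^d·card n)·‖b‖`: Cauchy–Schwarz and `‖X‖² ≤ card n·nhsNormSq X`), and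
  **`exactCurrent_sub_tension_pairing_le`**: for every such `τ` and every `b` with skew `extF P b`,
  `|τ b − Σ_x Σ_ν hsR (frame U (extF P b) x ν) (T_ν(x))| ≤ 12·#Plane(d)·a²·√(d·P^d·card n)·‖b‖` — hypothesis `hτT` of
  `NE7TensionKernelCoercivity.tension_energy_le_of_exact_annihilator` with `θ₀ = 12·#Plane·a²·√(d·P^d·card n)` (on the skew forms), and
  `exactCurrent_resF_gaugeDir` (`τ (resF P (gaugeDir U ζ)) = 0` for periodic `ζ`).
What remains for (E3″) after this file: `τ = 0` on the tangent directions is `critical_of_interior_isMinimiser` (file `NE7MinimiserTensionPairing`, via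
`hasDerivAt_fineAction_vary_dAction` and uniqueness of derivatives — stated here as `dAction_eq_zero_of_critical`); the model facts `Q = S + DΛ` and gauge
covariance for the honest linearised average (the tree's `NE3TangentCovariantStructure.cpush_gaugeDir`, one step); (α_S), (β_S); (8).
HONEST FRAMING (page 1): [folklore] bookkeeping at ONE configuration; nothing about minimisers is proved here beyond re-assembly; NE7, NE3 NOT PRINTED in
[Balaban1984PropagatorsI]–[Balaban1989LargeFieldII] and NOT PROVED; FIXED FINITE torus, rung (B)+1; continuum YM on T⁴ ⇐ BetaPertH ∧ nine spine estimates
(0/9 proved); BetaPertH ⇐ (D1) ∧ (D4) ∧ CAP+tail; G-an2-4 gates asym, D1 and NE2/3/4; NOT infinite volume, NOT mass gap, NOT Clay.  0 def, 0 sorry.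
-/

set_option autoImplicit false

open scoped BigOperators Matrix Matrix.Norms.L2Operator Topology InnerProductSpace
open NormedSpace Finset

namespace Summit.QuantumFields.BalabanUV.T4Continuum.NE7ExactCurrent

open Literature.MathematicalPhysics.QuantumFieldTheory.Balaban1983to89
open B7Prop1Explicit B7Prop2Explicit MatrixLog UnitaryModel MatrixNorms
open T4AveragingDeficitWall hiding Site Plane Plaq Bond
open T4AveragingDeficitWallBoundary (periodBox IsPeriodicCfg card_periodBox)
open AveragingDeficitTransport (Ad_mem_skewAdjoint)
open AveragingDeficitNearIdentity (Ad_real_smul)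
open AveragingDeficitPeriodicCounting (IsPeriodicDir)
open NE3HessShapes (plaqsOf)
open NE3HessForm (dAction hasDerivAt_fineAction_vary_at)
open NE3PureGaugeFirstVariation (dAction_gaugeDir curl_add)
open BlockAveragePushDirGauge (gaugeDir isPeriodicDir_gaugeDir)
open NE3CovariantCalculus (hsR cDstar)
open NE3CovariantWeitzenbock (frame)
open NE3HilbertSchmidtTorus
open NE7TensionPairing (firstVariation_sub_tension_pairing_le)

noncomputable section

variable {d : ℕ} {n : Type*} [Fintype n] [DecidableEq n]

/-! ## §1 `dAction` is linear in the direction and IS the first variation -/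

/-- The dressed curl is `ℝ`-homogeneous in the direction field. [folklore] -/
theorem curl_smul (V : Site d → Fin d → (Matrix n n ℂ)ˣ) (t : ℝ) (X : Site d → Fin d → Matrix n n ℂ) (p : T4AveragingDeficitWall.Plaq d) :
    curl V (t • X) p = t • curl V X p := by
  show curlAt V (t • X) p.1 p.2.1.1 p.2.1.2 = t • curlAt V X p.1 p.2.1.1 p.2.1.2
  simp only [curlAt, Pi.smul_apply, Ad_real_smul, smul_add, smul_sub]

/-- `dAction` is additive in the direction. [folklore] -/
theorem dAction_add (V : Site d → Fin d → (Matrix n n ℂ)ˣ) (X Y : Site d → Fin d → Matrix n n ℂ) (W : Finset (T4AveragingDeficitWall.Plaq d)) :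
    dAction V (X + Y) W = dAction V X W + dAction V Y W := by
  unfold dAction
  rw [← neg_add, ← Finset.sum_add_distrib]
  congr 1
  refine Finset.sum_congr rfl fun p _ => ?_
  rw [curl_add, add_mul, ← nReTrL_apply, map_add, nReTrL_apply, nReTrL_apply]

/-- `dAction` is `ℝ`-homogeneous in the direction. [folklore] -/
theorem dAction_smul (V : Site d → Fin d → (Matrix n n ℂ)ˣ) (t : ℝ) (X : Site d → Fin d → Matrix n n ℂ) (W : Finset (T4AveragingDeficitWall.Plaq d)) :
    dAction V (t • X) W = t * dAction V X W := by
  unfold dAction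
  rw [mul_neg, Finset.mul_sum]
  congr 1
  refine Finset.sum_congr rfl fun p _ => ?_
  rw [curl_smul, smul_mul_assoc, ← nReTrL_apply, map_smul, nReTrL_apply, smul_eq_mul]

/-- **`dAction U ψ W` IS THE FIRST VARIATION at `s = 0`** of `s ↦ fineAction (vary U ψ s) W` (the tree's `hasDerivAt_fineAction_vary_at` at `s = 0`). [folklore] -/
theorem hasDerivAt_fineAction_vary_dAction (V : Site d → Fin d → (Matrix n n ℂ)ˣ) (X : Site d → Fin d → Matrix n n ℂ)
    (W : Finset (T4AveragingDeficitWall.Plaq d)) :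
    HasDerivAt (fun s : ℝ => fineAction (vary V X s) W) (dAction V X W) 0 := by
  simpa using hasDerivAt_fineAction_vary_at V X W 0

/-- Conversely, CRITICALITY along `ψ` (`HasDerivAt … 0 0`, the shape of `NE7MinimiserTensionPairing.critical_of_interior_isMinimiser`) says `dAction = 0`
(uniqueness of derivatives). [folklore] -/
theorem dAction_eq_zero_of_critical {V : Site d → Fin d → (Matrix n n ℂ)ˣ} {X : Site d → Fin d → Matrix n n ℂ}
    {W : Finset (T4AveragingDeficitWall.Plaq d)} (h : HasDerivAt (fun s : ℝ => fineAction (vary V X s) W) 0 0) : dAction V X W = 0 :=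
  (hasDerivAt_fineAction_vary_dAction V X W).unique h

/-! ## §2 `dAction` against the tension pairing -/

section Pairing

variable {U : Site d → Fin d → (Matrix n n ℂ)ˣ} {B : Site d → Fin d → Fin d → Matrix n n ℂ} {ψ : Site d → Fin d → Matrix n n ℂ}

/-- **THE EXACT FIRST VARIATION IS THE TENSION PAIRING UP TO `12·#Plane·a²·‖ψ‖_{ℓ¹}`** (gen 62's `firstVariation_sub_tension_pairing_le` with
`D := dAction U ψ (plaqsOf (periodBox P))`). [folklore] -/
theorem dAction_sub_tension_pairing_le [Nonempty n] {P : ℕ} (hP : 1 ≤ P) (hU : IsUnitaryCfg U) (hUP : IsPeriodicCfg U (P : ℤ))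
    {a : ℝ} (ha0 : 0 ≤ a) (ha : a ≤ 1 / 4) (hUa : SmallField U a) (hψs : IsSkewDir ψ) (hψP : IsPeriodicDir ψ (P : ℤ))
    (hBF : ∀ (x : Site d) (μ ν : Fin d) (h : μ < ν), B x μ ν = flux U (x, ⟨(μ, ν), h⟩))
    (hanti : ∀ (x : Site d) (μ ν : Fin d), B x ν μ = -B x μ ν) :
    |dAction U ψ (plaqsOf (periodBox (d := d) P))
        - ∑ x ∈ periodBox (d := d) P, ∑ ν : Fin d, hsR (frame U ψ x ν) (∑ μ : Fin d, cDstar U μ (fun y => B y μ ν) x)|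
      ≤ 12 * (Fintype.card (T4AveragingDeficitWall.Plane d) : ℝ) * a ^ 2 * dirL1 ψ (periodBox (d := d) P) :=
  firstVariation_sub_tension_pairing_le hP hU hUP ha0 ha hUa hψs hψP hBF hanti (hasDerivAt_fineAction_vary_dAction U ψ _)

/-! ## §3 Pure gauge directions -/

/-- The gauge direction of a skew site field at a unitary configuration is skew. [folklore] -/
theorem isSkewDir_gaugeDir (hU : IsUnitaryCfg U) {ζ : Site d → Matrix n n ℂ} (hζ : ∀ x, ζ x ∈ skewAdjoint (Matrix n n ℂ)) :
    IsSkewDir (gaugeDir U ζ) := fun x μ =>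
  (skewAdjoint (Matrix n n ℂ)).sub_mem (Ad_mem_skewAdjoint ((unitaryUnits (Matrix n n ℂ)).inv_mem (hU x μ)) (hζ x)) (hζ (x + e μ))

/-- **THE TENSION IS `a²`-ORTHOGONAL TO EVERY PERIODIC PURE GAUGE DIRECTION**: for `P ≥ 1`, unitary `P`-periodic `U` in `SmallField U a` (`0 ≤ a ≤ 1∕4`),
a skew `P`-periodic site field `ζ` and the flux form `B`:
`|Σ_x Σ_ν hsR (frame U (gaugeDir U ζ) x ν) (T_ν(x))| ≤ 12·#Plane(d)·a²·dirL1 (gaugeDir U ζ) (periodBox P)` — the EXACT vanishing of the first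
variation on gauge directions (`dAction_gaugeDir`, gauge invariance of the Wilson action) through §2. [folklore] -/
theorem tension_pairing_gaugeDir_le [Nonempty n] {P : ℕ} (hP : 1 ≤ P) (hU : IsUnitaryCfg U) (hUP : IsPeriodicCfg U (P : ℤ))
    {a : ℝ} (ha0 : 0 ≤ a) (ha : a ≤ 1 / 4) (hUa : SmallField U a) {ζ : Site d → Matrix n n ℂ}
    (hζ : ∀ x, ζ x ∈ skewAdjoint (Matrix n n ℂ)) (hζP : ∀ (x : Site d) (i : Fin d), ζ (x + (P : ℤ) • e i) = ζ x)
    (hBF : ∀ (x : Site d) (μ ν : Fin d) (h : μ < ν), B x μ ν = flux U (x, ⟨(μ, ν), h⟩))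
    (hanti : ∀ (x : Site d) (μ ν : Fin d), B x ν μ = -B x μ ν) :
    |∑ x ∈ periodBox (d := d) P, ∑ ν : Fin d, hsR (frame U (gaugeDir U ζ) x ν) (∑ μ : Fin d, cDstar U μ (fun y => B y μ ν) x)|
      ≤ 12 * (Fintype.card (T4AveragingDeficitWall.Plane d) : ℝ) * a ^ 2 * dirL1 (gaugeDir U ζ) (periodBox (d := d) P) := by
  have h := dAction_sub_tension_pairing_le hP hU hUP ha0 ha hUa (isSkewDir_gaugeDir hU hζ) (isPeriodicDir_gaugeDir hUP hζP) hBF hanti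
  rwa [dAction_gaugeDir, zero_sub, abs_neg] at h

end Pairing

/-! ## §4 The exact current as a continuous linear functional on the torus 1-forms -/

section Torus

variable {U : Site d → Fin d → (Matrix n n ℂ)ˣ} {B : Site d → Fin d → Fin d → Matrix n n ℂ}

omit [Fintype n] [DecidableEq n] in
/-- `extF` is `ℝ`-homogeneous. [folklore] -/
theorem extF_smul (P : ℕ) [NeZero P] (t : ℝ) (b : Form d n P) (x : Site d) (κ : Fin d) : extF P (t • b) x κ = t • extF P b x κ := rfl

/-- **THE EXACT CURRENT EXISTS AS A CONTINUOUS LINEAR FUNCTIONAL** on `Form d n P`: `τ b = dAction U (extF P b) W` (linear by §1; continuous by finite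
dimension). [folklore] -/
theorem exists_exactCurrent (U : Site d → Fin d → (Matrix n n ℂ)ˣ) (P : ℕ) [NeZero P] (W : Finset (T4AveragingDeficitWall.Plaq d)) :
    ∃ τ : Form d n P →L[ℝ] ℝ, ∀ b : Form d n P, τ b = dAction U (extF P b) W := by
  let f : Form d n P →ₗ[ℝ] ℝ :=
    { toFun := fun b => dAction U (extF P b) W
      map_add' := fun a b => by
        have h : extF P (a + b) = extF P a + extF P b := funext fun x => funext fun κ => extF_add P a b x κ
        simp only [h, dAction_add]
      map_smul' := fun t b => by
        have h : extF P (t • b) = t • extF P b := funext fun x => funext fun κ => extF_smul P t b x κ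
        simp only [h, dAction_smul, RingHom.id_apply, smul_eq_mul] }
  exact ⟨LinearMap.toContinuousLinearMap f, fun b => rfl⟩

/-- **`‖·‖_{ℓ¹} ≤ √(d·P^d·card n)·‖·‖`** for the periodic extension of a torus 1-form: `dirL1 (extF P b) (periodBox P) ≤ √(d·P^d·card n)·‖b‖`
(Cauchy–Schwarz twice and `‖X‖² ≤ card n·nhsNormSq X`). [folklore] -/
theorem dirL1_extF_le [Nonempty n] (P : ℕ) [NeZero P] (b : Form d n P) :
    dirL1 (extF P b) (periodBox (d := d) P) ≤ Real.sqrt (d * (P : ℝ) ^ d * Fintype.card n) * ‖b‖ := by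
  have hnorm : ‖b‖ ^ 2 = ∑ x ∈ periodBox (d := d) P, ∑ κ : Fin d, nhsNormSq (extF P b x κ) := norm_sq_eq_sum_extF P b
  -- Cauchy–Schwarz on the double sum
  have hcs : (dirL1 (extF P b) (periodBox (d := d) P)) ^ 2
      ≤ (d * (P : ℝ) ^ d) * ∑ x ∈ periodBox (d := d) P, ∑ κ : Fin d, ‖extF P b x κ‖ ^ 2 := by
    unfold T4AveragingDeficitWall.dirL1
    calc (∑ x ∈ periodBox (d := d) P, ∑ κ : Fin d, ‖extF P b x κ‖) ^ 2
        ≤ (periodBox (d := d) P).card * ∑ x ∈ periodBox (d := d) P, (∑ κ : Fin d, ‖extF P b x κ‖) ^ 2 := sq_sum_le_card_mul_sum_sq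
      _ ≤ (periodBox (d := d) P).card * ∑ x ∈ periodBox (d := d) P, ((Finset.univ : Finset (Fin d)).card * ∑ κ : Fin d, ‖extF P b x κ‖ ^ 2) := by
          gcongr with x _
          exact sq_sum_le_card_mul_sum_sq
      _ = (d * (P : ℝ) ^ d) * ∑ x ∈ periodBox (d := d) P, ∑ κ : Fin d, ‖extF P b x κ‖ ^ 2 := by
          rw [card_periodBox, Finset.card_univ, Fintype.card_fin, ← Finset.mul_sum]; push_cast; ring
  have hop : ∑ x ∈ periodBox (d := d) P, ∑ κ : Fin d, ‖extF P b x κ‖ ^ 2 ≤ (Fintype.card n : ℝ) * ‖b‖ ^ 2 := by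
    rw [hnorm, Finset.mul_sum]
    refine Finset.sum_le_sum fun x _ => ?_
    rw [Finset.mul_sum]
    exact Finset.sum_le_sum fun κ _ => opNorm_sq_le_card_mul_nhsNormSq _
  have h0 : 0 ≤ dirL1 (extF P b) (periodBox (d := d) P) := by
    unfold T4AveragingDeficitWall.dirL1; positivity
  have hsq : (dirL1 (extF P b) (periodBox (d := d) P)) ^ 2 ≤ (Real.sqrt (d * (P : ℝ) ^ d * Fintype.card n) * ‖b‖) ^ 2 := by
    rw [mul_pow, Real.sq_sqrt (by positivity)]
    have hdP : (0 : ℝ) ≤ d * (P : ℝ) ^ d := by positivity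
    nlinarith [mul_le_mul_of_nonneg_left hop hdP]
  exact (pow_le_pow_iff_left₀ h0 (by positivity) two_ne_zero).mp hsq

/-- **THE EXACT CURRENT IS `θ₀`-CLOSE TO THE TENSION PAIRING ON SKEW TORUS 1-FORMS**, `θ₀ = 12·#Plane(d)·a²·√(d·P^d·card n)`: for `P ≥ 1`, unitary
`P`-periodic `U` in `SmallField U a` (`0 ≤ a ≤ 1∕4`), the flux form `B`, any `τ` with `τ b = dAction U (extF P b) (plaqsOf (periodBox P))`, and every `b`
whose extension is skew:  `|τ b − Σ_x Σ_ν hsR (frame U (extF P b) x ν) (T_ν(x))| ≤ θ₀·‖b‖` — hypothesis `hτT` of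
`NE7TensionKernelCoercivity.tension_energy_le_of_exact_annihilator` (on the skew forms). [folklore] -/
theorem exactCurrent_sub_tension_pairing_le [Nonempty n] {P : ℕ} [NeZero P] (hU : IsUnitaryCfg U) (hUP : IsPeriodicCfg U (P : ℤ))
    {a : ℝ} (ha0 : 0 ≤ a) (ha : a ≤ 1 / 4) (hUa : SmallField U a)
    (hBF : ∀ (x : Site d) (μ ν : Fin d) (h : μ < ν), B x μ ν = flux U (x, ⟨(μ, ν), h⟩))
    (hanti : ∀ (x : Site d) (μ ν : Fin d), B x ν μ = -B x μ ν)
    {τ : Form d n P →L[ℝ] ℝ} (hτ : ∀ b : Form d n P, τ b = dAction U (extF P b) (plaqsOf (periodBox (d := d) P)))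
    {b : Form d n P} (hb : IsSkewDir (extF P b)) :
    |τ b - ∑ x ∈ periodBox (d := d) P, ∑ ν : Fin d, hsR (frame U (extF P b) x ν) (∑ μ : Fin d, cDstar U μ (fun y => B y μ ν) x)|
      ≤ (12 * (Fintype.card (T4AveragingDeficitWall.Plane d) : ℝ) * a ^ 2 * Real.sqrt (d * (P : ℝ) ^ d * Fintype.card n)) * ‖b‖ := by
  have hP : 1 ≤ P := Nat.one_le_iff_ne_zero.mpr (NeZero.ne P)
  rw [hτ b]
  refine (dAction_sub_tension_pairing_le hP hU hUP ha0 ha hUa hb (isPeriodicDir_extF P b) hBF hanti).trans ?_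
  have h := dirL1_extF_le (d := d) P b
  have hc : 0 ≤ 12 * (Fintype.card (T4AveragingDeficitWall.Plane d) : ℝ) * a ^ 2 := by positivity
  calc 12 * (Fintype.card (T4AveragingDeficitWall.Plane d) : ℝ) * a ^ 2 * dirL1 (extF P b) (periodBox (d := d) P)
      ≤ 12 * (Fintype.card (T4AveragingDeficitWall.Plane d) : ℝ) * a ^ 2 * (Real.sqrt (d * (P : ℝ) ^ d * Fintype.card n) * ‖b‖) :=
        mul_le_mul_of_nonneg_left h hc
    _ = _ := by ring

/-- **THE EXACT CURRENT VANISHES ON PERIODIC PURE GAUGE TORUS DIRECTIONS**: `τ (resF P (gaugeDir U ζ)) = 0` for `P`-periodic `U`, `ζ`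
(`extF_resF` of the periodic gauge direction, then `dAction_gaugeDir`). [folklore] -/
theorem exactCurrent_resF_gaugeDir {P : ℕ} [NeZero P] (hUP : IsPeriodicCfg U (P : ℤ)) {ζ : Site d → Matrix n n ℂ}
    (hζP : ∀ (x : Site d) (i : Fin d), ζ (x + (P : ℤ) • e i) = ζ x) (W : Finset (T4AveragingDeficitWall.Plaq d))
    {τ : Form d n P →L[ℝ] ℝ} (hτ : ∀ b : Form d n P, τ b = dAction U (extF P b) W) :
    τ (resF (d := d) P (gaugeDir U ζ)) = 0 := by
  rw [hτ, extF_resF P (isPeriodicDir_gaugeDir hUP hζP), dAction_gaugeDir]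

/-- **THE EXACT CURRENT VANISHES ON CRITICAL DIRECTIONS**: if `U` is critical along `extF P b` for the action of the window `W` (the shape
`critical_of_interior_isMinimiser` produces for tangent directions of an interior constrained minimiser), then `τ b = 0`. [folklore] -/
theorem exactCurrent_eq_zero_of_critical {P : ℕ} [NeZero P] (W : Finset (T4AveragingDeficitWall.Plaq d))
    {τ : Form d n P →L[ℝ] ℝ} (hτ : ∀ b : Form d n P, τ b = dAction U (extF P b) W) {b : Form d n P}
    (hcrit : HasDerivAt (fun s : ℝ => fineAction (vary U (extF P b) s) W) 0 0) : τ b = 0 := by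
  rw [hτ b]
  exact dAction_eq_zero_of_critical hcrit

end Torus

end

end Summit.QuantumFields.BalabanUV.T4Continuum.NE7ExactCurrent
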